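import Mathlib
import Summits.ResolutionOfSingularities.ResolutionOfSingularities.Theorems.RadicialJungCleanModelsCleanPatchingDefs
import Summits.ResolutionOfSingularities.ResolutionOfSingularities.Theorems.RadicialJungCleanModelsCleanRegTransport
import Summits.ResolutionOfSingularities.ResolutionOfSingularities.Theorems.RadicialJungCleanModelsCleanResolvingSystemDim
import Summits.ResolutionOfSingularities.ResolutionOfSingularities.Theorems.RadicialJungCleanModelsModelOfOpenImmersion
import Summits.ResolutionOfSingularities.ResolutionOfSingularities.Theorems.RadicialJungCleanModelsCentreCharts
import Summits.ResolutionOfSingularities.ResolutionOfSingularities.Theorems.RadicialJungCleanModelsWChartsDim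
import Summits.ResolutionOfSingularities.ResolutionOfSingularities.Theorems.RadicialJungCleanModelsReductionAt
import Summits.ResolutionOfSingularities.ResolutionOfSingularities.Theorems.RadicialJungCleanModelsCleanChartsZeroDimDim
import Literature.AlgebraicGeometry.Resolution.ChowLemmaProofs
import Literature.AlgebraicGeometry.Resolution.ResolutionProjectiveReduction
import Literature.AlgebraicGeometry.Resolution.ResolvingSystems
import Literature.AlgebraicGeometry.Resolution.PrincipalizationToResolution
import Literature.AlgebraicGeometry.Resolution.ResolutionGlue
import Literature.AlgebraicGeometry.Resolution.QuasiProjectiveResolution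
import Literature.AlgebraicGeometry.Resolution.AlterationsResolution
import Literature.AlgebraicGeometry.Resolution.BadCurveInduction
import Literature.AlgebraicGeometry.Motives.CyclesGraphClosure
import Literature.AlgebraicGeometry.Motives.RatFnBirational
import HarnessLib

/-!
# Route `RadicialJung`, crux `CleanModels` (stmt-ResolutionOfSingularities-15917), line `Sketch` rev 35: THE GLUE IN EVERY DIMENSION,
# and the frontier stub `stub_cleanModelsDimGEFour` REDUCED BY NAME to clean charts + two-model patching for `P_clean` in dimension `≥ 4`

The landed stub 4c `stub_cleanGlobalization3` (`RadicialJungCleanModelsStubCleanGlobalization3.lean`) — CLEAN CHARTS along every valuation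
+ OPEN-FORM TWO-MODEL PATCHING for `P_clean` ⟹ loose log-clean principalization on regular threefolds in the `W`-form of the pointwise
reduction `cleanModelsAt_of_logCleanPrincipalizationAt` — is Zariski's globalization RELATIVE TO `W` (Chow `ChowLemmaIntegral_holds` + projective
closure `exists_projectiveClosure`; the affine charts of `W` read in `K(X')`; a finite clean resolving system patched over the closure; restriction
over `X'`; transport of `CleanRegAt`).  NOTHING in that proof is three-dimensional: the dimension only threads through the two hypotheses.  This
file records

* `cleanGlobalization_dim` — the same glue for regular `W` of ANY dimension `d` (hypotheses: clean charts over regular affine `d`-dimensional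
  models, two-model patching for `P_clean` in transcendence degree `d`; proof = the dim-3 proof verbatim over the dimension-free helpers
  `exists_regular_chart_dim` / `exists_model_cleanOn_over_charts_dim`);
* `cleanModelsDimGEFour_of_cleanCharts_of_cleanTwoModelPatching` — the registered frontier stub `stub_cleanModelsDimGEFour` of
  `Cruxes/CleanModels/Lines/Sketch.lean` rev 35 (its statement VERBATIM) from those two inputs asked in every dimension `d ≥ 4`, through
  `exists_nat_topologicalKrullDim_eq` and the landed pointwise reduction `cleanModelsAt_of_logCleanPrincipalizationAt` (p657305's file);
* `cleanModelsDimGEFour_of_cleanLUZeroDim_of_cleanTwoModelPatching` — the same with clean charts replaced by their source, CLEAN LOCAL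
  UNIFORMIZATION at zero-dimensional valuations with a `d`-dimensional regular centre (dimension-free `cleanCharts_dim_of_cleanLUZeroDim_dim`):
  the dim `≥ 4` twin of the skeleton's dim-3 chain, whose two inputs are the dim-`d` forms of `cleanLU3_of_stubs` and `stub_cleanTwoModelPatching3`.

So the dimension cut of the crux is now uniform: in EVERY dimension `d ≥ 3`, `CleanModels` ⟸ (clean charts)_d ∧ (two-model patching for
`P_clean`)_d, with the glue PROVED; for `d = 3` the two inputs are the landed `cleanCharts3_of_cleanLU3ZeroDim` / `stub_cleanTwoModelPatching3`
chains of the skeleton, for `d ≥ 4` BOTH inputs are OPEN — clean local uniformization in dimension `≥ 4` (open even without cleanness) and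
Piltant's Prop. 5.1 for `P_clean` in dimension `≥ 4` («All of these problems are open in dimension four or more», Piltant 2013, p. 2; cf.
`Literature/…/ZariskiPatchingAllDimensions.lean` for `P_reg`).  Honest framing: a structural reduction, counted 0; nothing here proves
resolution of singularities in characteristic `p`, and `CleanModels` in `dim ≥ 3` remains unsettled.
-/

noncomputable section

set_option linter.dupNamespace false -- mandated namespace of this single-conjunct summit

open CategoryTheory AlgebraicGeometry IsLocalRing TopologicalSpace
open Literature.AlgebraicGeometry.Resolution Literature.AlgebraicGeometry.Motives

namespace Summit.ResolutionOfSingularities.ResolutionOfSingularities.Theorems.RadicialJung.CleanModels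

/-- **The glue in dimension `d`** (dimension-free form of the landed stub 4c `stub_cleanGlobalization3`, see the module docstring):
clean charts along every valuation over regular affine `d`-dimensional models + open-form two-model patching for `P_clean(g₀)` in
transcendence degree `d` ⟹ on every regular integral `W`, separated of finite type over `k`, of dimension `d`, every `g₀ ∈ K(W) ∖ K(W)^p`
has a proper birational regular `V → W` on which some non-trivial representative of its `K(W)^p`-line is loosely clean at every point.
[cite: Piltant2013, Cor. 5.7] [cite: CossartPiltant2019, Prop. 4.6 (arXiv v1: Prop. 4.4), proof, Steps 1–3] -/
theorem cleanGlobalization_dim {d : ℕ}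
    (hcharts : ∀ (p : ℕ), p.Prime → ∀ (k : Type) [Field k] [CharP k p] (K : Type) [Field K] [Algebra k K]
    (O : ValuationSubring K) (A : Subalgebra k K), A.toSubring ≤ O.toSubring → A.FG → IsFractionRing A K →
    ringKrullDim A ≤ (d : WithBot ℕ∞) →
    (∀ (𝔪 : Ideal A.toSubring) [𝔪.IsMaximal],
    IsRegularLocalRing (Localization.AtPrime 𝔪) ∧ ringKrullDim (Localization.AtPrime 𝔪) = (d : WithBot ℕ∞)) →
    ∀ g₀ : K, (∀ c : K, c ^ p ≠ g₀) →
    ∃ T : Subalgebra k K, T.FG ∧ A ≤ T ∧ T.toSubring ≤ O.toSubring ∧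
    ∀ O' : ValuationSubring K, T.toSubring ≤ O'.toSubring →
    CleanRegAt p (locAtCentre T.toSubring O').subtype g₀)
    (hZ : ∀ (p : ℕ), p.Prime → ∀ (k K : Type) [Field k] [CharP k p] [Field K] [Algebra k K] [Algebra.EssFiniteType k K],
    Algebra.trdeg k K = d → ∀ (g₀ : K) (M₁ M₂ : ProjModel k K) (U₁ : M₁.X.Opens) (U₂ : M₂.X.Opens),
    (∀ x ∈ U₁, ModelCleanRegAt p g₀ M₁ x) → (∀ x ∈ U₂, ModelCleanRegAt p g₀ M₂ x) →
    ∃ (N : ProjModel k K) (φ₁ : N.Hom M₁) (φ₂ : N.Hom M₂),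
    (∀ y : N.X, φ₁.f y ∈ U₁ → ModelCleanRegAt p g₀ N y) ∧ (∀ y : N.X, φ₂.f y ∈ U₂ → ModelCleanRegAt p g₀ N y)) :
    ∀ (p : ℕ), p.Prime → ∀ (k : Type) [Field k] [CharP k p] (W : Scheme.{0}) [IsIntegral W]
      (f : W ⟶ Spec (.of k)) [IsSeparated f] [LocallyOfFiniteType f] [QuasiCompact f],
      Scheme.IsRegular W → topologicalKrullDim W = (d : WithBot ℕ∞) →
      ∀ g₀ : W.functionField, (∀ c : W.functionField, c ^ p ≠ g₀) →
      ∃ (V : Scheme.{0}) (π : V ⟶ W) (_ : IsIntegral V) (_ : IsDominant π),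
        IsProper π ∧ IsBirational π ∧ Scheme.IsRegular V ∧
        ∀ v : V, ∃ c : Fin p → W.functionField, (∃ j : Fin p, (j : ℕ) ≠ 0 ∧ c j ≠ 0) ∧
          ((∃ (d m : ℕ) (hmd : m ≤ d) (t : Fin d → V.presheaf.stalk v) (a : Fin m → ℕ)
              (u : V.presheaf.stalk v), IsUnit u ∧
              Ideal.span (Set.range t) = IsLocalRing.maximalIdeal (V.presheaf.stalk v) ∧
              ringKrullDim (V.presheaf.stalk v) = (d : WithBot ℕ∞) ∧ 0 < m ∧ (∀ i, ¬ p ∣ a i) ∧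
              RatFn.functionFieldMap π (∑ j : Fin p, c j ^ p * g₀ ^ (j : ℕ)) =
                algebraMap (V.presheaf.stalk v) V.functionField
                  (u * ∏ i : Fin m, t (Fin.castLE hmd i) ^ (a i))) ∨
            (∃ u : V.presheaf.stalk v, IsUnit u ∧
              RatFn.functionFieldMap π (∑ j : Fin p, c j ^ p * g₀ ^ (j : ℕ)) =
                algebraMap (V.presheaf.stalk v) V.functionField u ∧
              ∀ c' : V.presheaf.stalk v,
                u - c' ^ p ∉ IsLocalRing.maximalIdeal (V.presheaf.stalk v)) ∨
            (∃ s c' : V.presheaf.stalk v,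
              RatFn.functionFieldMap π (∑ j : Fin p, c j ^ p * g₀ ^ (j : ℕ)) =
                algebraMap (V.presheaf.stalk v) V.functionField s ∧
              s - c' ^ p ∈ IsLocalRing.maximalIdeal (V.presheaf.stalk v) ∧
              s - c' ^ p ∉ IsLocalRing.maximalIdeal (V.presheaf.stalk v) ^ 2)) := by
  intro p hp k _ _ W _ f _ _ _ hWreg hdim3 g₀ hg₀
  classical
  haveI : Fact p.Prime := ⟨hp⟩
  /- (1) Chow and a projective closure: `W ← X' ↪ X̄ ⊆ ℙⁿ` -/
  obtain ⟨n, X', π₁, ι, hX'int, hι, hπ₁prop, hsurj, hcomm, U₀, hU₀, hU₀', hiso₀⟩ :=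
    ChowLemmaIntegral_holds k W f inferInstance inferInstance inferInstance inferInstance
  haveI := hX'int
  haveI := hι
  haveI := hπ₁prop
  haveI := hsurj
  haveI : IsDominant π₁ := inferInstance
  haveI := hiso₀
  have hbir₁ : IsBirational π₁ := ⟨U₀, hU₀, hU₀', hiso₀⟩
  have hbij₁ : Function.Bijective (RatFn.functionFieldMap π₁) :=
    RatFn.functionFieldMap_bijective_of_isIso_morphismRestrict π₁ U₀ hU₀ hU₀'
  obtain ⟨Xbar, jcl, c, hXbar, hjcl, hc, hjc, -⟩ := exists_projectiveClosure ι
  haveI := hXbar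
  haveI := hjcl
  haveI := hc
  haveI : IsDominant jcl := isDominant_of_isOpenImmersion jcl
  haveI : IsProper (Literature.AlgebraicGeometry.Motives.projectiveSpace n k).hom :=
    Literature.AlgebraicGeometry.Motives.isProper_projectiveSpace n k
  let πXbar : Xbar ⟶ Spec (.of k) := c ≫ (Literature.AlgebraicGeometry.Motives.projectiveSpace n k).hom
  have hproj : Literature.AlgebraicGeometry.Motives.IsProjectiveOver (Over.mk πXbar) := ⟨n, Over.homMk c rfl, hc⟩
  have hstruct : jcl ≫ πXbar = π₁ ≫ f := by
    change jcl ≫ c ≫ _ = _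
    rw [← Category.assoc, hjc]
    exact hcomm
  /- (2) `K := K(X')` with the `k`-structure read off `X̄ → Spec k`; `X̄` as a projective model of `K` -/
  letI : Algebra k X'.functionField := algebraOfStructureMorphism jcl πXbar
  have halg := specMap_algebraMap_eq jcl πXbar
  have halgW : Spec.map (CommRingCat.ofHom (algebraMap k X'.functionField)) =
      X'.fromSpecStalk (genericPoint X') ≫ π₁ ≫ f := by rw [halg, hstruct]
  let M₀ : ProjModel k X'.functionField := ProjModel.ofOpenImmersion jcl πXbar hproj halg
  haveI : CharP X'.functionField p := charP_of_injective_algebraMap (algebraMap k X'.functionField).injective p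
  -- the line upstairs
  let g₁ : X'.functionField := RatFn.functionFieldMap π₁ g₀
  have hg₁ : ∀ c' : X'.functionField, c' ^ p ≠ g₁ := by
    intro c' hc'
    obtain ⟨c₀, rfl⟩ := hbij₁.2 c'
    exact hg₀ c₀ (hbij₁.1 (by rw [map_pow]; exact hc'))
  /- (3) the regular charts of `W`, read in `K` -/
  haveI : CompactSpace W := QuasiCompact.compactSpace_of_compactSpace f
  have hcovW : ∀ x : W, ∃ U : W.Opens, IsAffineOpen U ∧ x ∈ U := fun x => by
    obtain ⟨_, ⟨U, hU, rfl⟩, hxU, -⟩ := W.isBasis_affineOpens.exists_subset_of_mem_open (Set.mem_univ x) isOpen_univ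
    exact ⟨U, hU, hxU⟩
  choose UW hUWaff hxUW using hcovW
  obtain ⟨t, ht⟩ := isCompact_univ.elim_finite_subcover (fun x : W => (UW x : Set W)) (fun x => (UW x).2)
    (fun x _ => Set.mem_iUnion.mpr ⟨x, hxUW x⟩)
  let ιW : Type := ↥t
  haveI : Finite ιW := inferInstance
  have hne : ∀ i : ιW, Nonempty (UW i.1) := fun i => ⟨⟨i.1, hxUW i.1⟩⟩
  have hchart : ∀ i : ιW, ∃ A : Subalgebra k X'.functionField, A.FG ∧ IsFractionRing A X'.functionField ∧
      ringKrullDim A ≤ (d : WithBot ℕ∞) ∧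
      (∀ (𝔪 : Ideal A.toSubring) [𝔪.IsMaximal],
        IsRegularLocalRing (Localization.AtPrime 𝔪) ∧ ringKrullDim (Localization.AtPrime 𝔪) = (d : WithBot ℕ∞)) ∧
      ∀ z, z ∈ A ↔ ∃ a : Γ(W, UW i.1),
        RatFn.functionFieldMap π₁ (@Scheme.germToFunctionField W _ (UW i.1) (hne i) a) = z := by
    intro i
    haveI := hne i
    exact exists_regular_chart_dim f π₁ halgW hWreg hdim3 hbij₁ (UW i.1) (hUWaff i.1)
  choose A hAfg hAfr hAdim hAmax hAmem using hchart
  /- (4) `K/k` is essentially of finite type of transcendence degree `d` -/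
  haveI : Nonempty ιW := by
    obtain ⟨x₀⟩ : Nonempty W := ⟨genericPoint W⟩
    obtain ⟨i, hi, -⟩ := Set.mem_iUnion₂.mp (ht (Set.mem_univ x₀))
    exact ⟨⟨i, hi⟩⟩
  obtain ⟨i₀⟩ := (inferInstance : Nonempty ιW)
  haveI : Algebra.FiniteType k (A i₀) := (A i₀).fg_iff_finiteType.mp (hAfg i₀)
  haveI := hAfr i₀
  haveI : Algebra.EssFiniteType (A i₀) X'.functionField :=
    Algebra.EssFiniteType.of_isLocalization X'.functionField (nonZeroDivisors (A i₀))
  haveI : Algebra.EssFiniteType k X'.functionField :=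
    Algebra.EssFiniteType.comp k (A i₀) X'.functionField
  have htr : Algebra.trdeg k X'.functionField = d := by
    obtain ⟨m, hm, htrm⟩ := exists_ringKrullDim_eq_and_trdeg_eq k (A i₀)
    -- `dim (A i₀) = d`: a maximal localisation has dimension `d ≤ dim ≤ d`
    have hA3 : ringKrullDim (A i₀) = (d : WithBot ℕ∞) := by
      refine le_antisymm (hAdim i₀) ?_
      obtain ⟨𝔪, h𝔪⟩ := Ideal.exists_maximal (A i₀).toSubring
      obtain ⟨-, hd⟩ := hAmax i₀ 𝔪
      rw [← hd, IsLocalization.AtPrime.ringKrullDim_eq_height 𝔪 (Localization.AtPrime 𝔪)]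
      exact Ideal.height_le_ringKrullDim_of_ne_top h𝔪.ne_top
    have hm3 : m = d := by
      have : (m : WithBot ℕ∞) = (d : WithBot ℕ∞) := by rw [← hm]; exact hA3
      exact_mod_cast this
    rw [trdeg_eq_trdeg_of_isFractionRing (A i₀), htrm, hm3]
  /- (5) the patched model `N → X̄` with a clean open containing every centre of a valuation centred on a chart of `W` -/
  obtain ⟨N, ψ, VN, hVN, hcen⟩ := exists_model_cleanOn_over_charts_dim (p := p) (g₀ := g₁) (d := d)
    (fun O B hBO hBfg hBfr hBdim hBmax => hcharts p hp k X'.functionField O B hBO hBfg hBfr hBdim hBmax g₁ hg₁)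
    (fun M₁ M₂ U₁ U₂ h₁ h₂ => hZ p hp k X'.functionField htr g₁ M₁ M₂ U₁ U₂ h₁ h₂)
    A hAfg hAfr hAdim (fun i 𝔪 _ => hAmax i 𝔪) M₀
  /- (6) every point of `N` over `X'` is clean-regular -/
  have hcleanN : ∀ y : N.X, ψ.f y ∈ jcl.opensRange → ModelCleanRegAt p g₁ N y := by
    intro y hy
    have hgen : IsGenericPoint N.toKModel.genericPt (Set.univ : Set N.X) := by
      rw [N.genericPt_eq']; exact genericPoint_spec N.X
    obtain ⟨w, hw⟩ := N.toKModel.exists_isCentre_of_isGenericPoint hgen y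
    have hyc : y = N.centre w := ProjModel.eq_centre_of_isCentre hw
    have hM₀c : M₀.centre w ∈ jcl.opensRange := by
      rw [← ψ.map_centre w, ← hyc]; exact hy
    obtain ⟨x', hx', hcharts'⟩ := exists_point_forall_chart_le jcl πXbar hproj halg π₁ w hM₀c
    -- the chart of `W` through `π₁ x'`
    obtain ⟨i, hi, hxi⟩ := Set.mem_iUnion₂.mp (ht (Set.mem_univ (π₁ x')))
    have hAi : (A ⟨i, hi⟩).toSubring ≤ w.asValuationSubring.toSubring := by
      intro z hz
      obtain ⟨a, rfl⟩ := (hAmem ⟨i, hi⟩ z).mp hz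
      exact hcharts' (UW i) (hUWaff i) hxi a
    have := hcen w ⟨⟨i, hi⟩, hAi⟩
    rw [hyc]
    exact hVN _ this
  /- (7) `V := ψ⁻¹(X') → X' → W` -/
  let ψf : N.X ⟶ Xbar := ψ.f
  haveI : IsProper ψf := inferInstanceAs (IsProper ψ.f)
  haveI : IsDominant ψf := inferInstanceAs (IsDominant ψ.f)
  let U₁ : Xbar.Opens := jcl.opensRange
  let πres := ψf ∣_ U₁
  let e : X' ≅ ↑U₁ := jcl.isoOpensRange
  let πV : ↑(ψf ⁻¹ᵁ U₁) ⟶ X' := πres ≫ e.inv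
  let π : ↑(ψf ⁻¹ᵁ U₁) ⟶ W := πV ≫ π₁
  have hπV : πV ≫ jcl = (ψf ⁻¹ᵁ U₁).ι ≫ ψf := by
    change (πres ≫ e.inv) ≫ jcl = _
    rw [Category.assoc, Scheme.Hom.isoOpensRange_inv_comp, morphismRestrict_ι]
  -- `V` is integral (a non-empty open of the integral `N`)
  have hgenV : genericPoint N.X ∈ ψf ⁻¹ᵁ U₁ := by
    change ψ.f (genericPoint N.X) ∈ U₁
    rw [ψ.f_genericPoint]
    change genericPoint Xbar ∈ jcl.opensRange
    rw [← RatFn.genericPoint_eq_of_isDominant jcl]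
    exact ⟨_, rfl⟩
  haveI : Nonempty ↑(ψf ⁻¹ᵁ U₁) := ⟨⟨_, hgenV⟩⟩
  haveI : IsIntegral (↑(ψf ⁻¹ᵁ U₁) : Scheme.{0}) := isIntegral_of_isOpenImmersion (ψf ⁻¹ᵁ U₁).ι
  have hψbir : IsBirational ψf := ψ.isBirational
  have hπVbir : IsBirational πV := (hψbir.morphismRestrict U₁).comp_iso e.inv
  haveI : IsDominant πV := hπVbir.isDominant
  have hπbir : IsBirational π := hπVbir.comp hbir₁
  haveI : IsDominant π := hπbir.isDominant
  have hπbij : Function.Bijective (RatFn.functionFieldMap π) := by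
    obtain ⟨U, hU, hU', hisoU⟩ := hπbir
    haveI := hisoU
    exact RatFn.functionFieldMap_bijective_of_isIso_morphismRestrict π U hU hU'
  haveI : IsDominant (ψf ⁻¹ᵁ U₁).ι := isDominant_of_isOpenImmersion _
  -- equal dominant morphisms have equal pull-backs on function fields
  have ffcongr : ∀ {Y : Scheme.{0}} [IsIntegral Y] (a b : ↑(ψf ⁻¹ᵁ U₁) ⟶ Y) [IsDominant a] [IsDominant b],
      a = b → RatFn.functionFieldMap a = RatFn.functionFieldMap b := by
    rintro Y _ a b _ _ rfl; rfl
  have hpoint : ∀ v : ↑(ψf ⁻¹ᵁ U₁), ψ.f ((ψf ⁻¹ᵁ U₁).ι v) ∈ jcl.opensRange := fun v => by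
    rw [Scheme.Opens.ι_apply]; exact v.2
  refine ⟨↑(ψf ⁻¹ᵁ U₁), π, inferInstance, inferInstance, ?_, hπbir, ?_, ?_⟩
  · -- proper
    change IsProper ((πres ≫ e.inv) ≫ π₁)
    infer_instance
  · -- regular
    intro v
    haveI := (hcleanN _ (hpoint v)).isRegularLocalRing_stalk
    exact IsRegularLocalRing.of_ringEquiv (asIso (((ψf ⁻¹ᵁ U₁).ι).stalkMap v)).commRingCatIsoToRingEquiv
  · -- loose clean forms at every point
    intro v
    have h1 := (modelCleanRegAt_iff_stalk N _).mp (hcleanN _ (hpoint v))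
    have h2 := CleanRegAt.functionFieldMap_of_isIso_stalkMap (ψf ⁻¹ᵁ U₁).ι v h1
    -- the rational function upstairs is `π^♯ g₀`
    have hG : RatFn.functionFieldMap (ψf ⁻¹ᵁ U₁).ι (N.funFieldIso.inv.hom g₁) = RatFn.functionFieldMap π g₀ := by
      haveI : IsDominant (πV ≫ jcl) := MorphismProperty.comp_mem @IsDominant πV jcl inferInstance inferInstance
      haveI : IsDominant ((ψf ⁻¹ᵁ U₁).ι ≫ ψf) :=
        MorphismProperty.comp_mem @IsDominant _ _ inferInstance inferInstance
      haveI : IsDominant (πV ≫ π₁) := MorphismProperty.comp_mem @IsDominant πV π₁ inferInstance inferInstance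
      have hcomp : ∀ {A₁ B₁ C₁ : Scheme.{0}} [IsIntegral A₁] [IsIntegral B₁] [IsIntegral C₁] (g' : A₁ ⟶ B₁) (f' : B₁ ⟶ C₁)
          [IsDominant g'] [IsDominant f'] [IsDominant (g' ≫ f')] (x : C₁.functionField),
          RatFn.functionFieldMap (g' ≫ f') x = RatFn.functionFieldMap g' (RatFn.functionFieldMap f' x) := by
        intro A₁ B₁ C₁ _ _ _ g' f' _ _ _ x
        exact RingHom.congr_fun (RatFn.functionFieldMap_comp f' g') x
      -- everything below is typed over `Xbar` (not the defeq `M₀.X`) so that instances match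
      have e0 : N.funFieldIso.inv.hom g₁ = RatFn.functionFieldMap ψf (M₀.funFieldIso.inv.hom g₁) :=
        (ProjModel.functionFieldMap_funFieldIso_inv ψ g₁).symm
      have e1 : RatFn.functionFieldMap ((ψf ⁻¹ᵁ U₁).ι ≫ ψf) = RatFn.functionFieldMap (πV ≫ jcl) :=
        ffcongr ((ψf ⁻¹ᵁ U₁).ι ≫ ψf) (πV ≫ jcl) hπV.symm
      have e2 : RatFn.functionFieldMap jcl (M₀.funFieldIso.inv.hom g₁) = g₁ :=
        ProjModel.functionFieldMap_funFieldIso_inv_ofOpenImmersion jcl πXbar hproj halg g₁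
      calc RatFn.functionFieldMap (ψf ⁻¹ᵁ U₁).ι (N.funFieldIso.inv.hom g₁)
          = RatFn.functionFieldMap (ψf ⁻¹ᵁ U₁).ι (RatFn.functionFieldMap ψf (M₀.funFieldIso.inv.hom g₁)) := by
            rw [e0]
        _ = RatFn.functionFieldMap ((ψf ⁻¹ᵁ U₁).ι ≫ ψf) (M₀.funFieldIso.inv.hom g₁) := (hcomp _ _ _).symm
        _ = RatFn.functionFieldMap (πV ≫ jcl) (M₀.funFieldIso.inv.hom g₁) := by rw [e1]
        _ = RatFn.functionFieldMap πV (RatFn.functionFieldMap jcl (M₀.funFieldIso.inv.hom g₁)) := hcomp _ _ _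
        _ = RatFn.functionFieldMap πV g₁ := by rw [e2]
        _ = RatFn.functionFieldMap πV (RatFn.functionFieldMap π₁ g₀) := rfl
        _ = RatFn.functionFieldMap (πV ≫ π₁) g₀ := (hcomp _ _ _).symm
    rw [hG] at h2
    obtain ⟨_, c', hc', hform⟩ := h2
    -- pull the representative back along the bijective `π^♯`
    choose c hc using fun j => hπbij.2 (c' j)
    refine ⟨c, ?_, ?_⟩
    · obtain ⟨j, hj, hj'⟩ := hc'
      exact ⟨j, hj, fun h0 => hj' (by rw [← hc j, h0, map_zero])⟩
    · have hsum : (∑ j : Fin p, c' j ^ p * RatFn.functionFieldMap π g₀ ^ (j : ℕ)) =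
          RatFn.functionFieldMap π (∑ j : Fin p, c j ^ p * g₀ ^ (j : ℕ)) := by
        rw [map_sum]
        refine Finset.sum_congr rfl fun j _ => ?_
        rw [map_mul, map_pow, map_pow, hc]
      rw [hsum] at hform
      exact hform


/-- **The frontier stub `stub_cleanModelsDimGEFour` (Sketch rev 35, statement VERBATIM) from clean charts and two-model patching for
`P_clean` in every dimension `d ≥ 4`.**  `W` has dimension some `d : ℕ` (`exists_nat_topologicalKrullDim_eq`), `d ≥ 4` by hypothesis;
the glue `cleanGlobalization_dim` gives loose log-clean principalization of every `g₀ ∈ K(W) ∖ K(W)^p` on `W`, and the landed pointwise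
reduction `cleanModelsAt_of_logCleanPrincipalizationAt` turns it into the conclusion of `CleanModels` for `(W, L)`.  Both inputs are OPEN
in dimension `≥ 4`; this is a structural reduction only. [cite: Piltant2013, Cor. 5.7 and p. 2] -/
theorem cleanModelsDimGEFour_of_cleanCharts_of_cleanTwoModelPatching
    (hcharts : ∀ d : ℕ, 4 ≤ d → ∀ (p : ℕ), p.Prime → ∀ (k : Type) [Field k] [CharP k p] (K : Type) [Field K] [Algebra k K]
    (O : ValuationSubring K) (A : Subalgebra k K), A.toSubring ≤ O.toSubring → A.FG → IsFractionRing A K →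
    ringKrullDim A ≤ (d : WithBot ℕ∞) →
    (∀ (𝔪 : Ideal A.toSubring) [𝔪.IsMaximal],
    IsRegularLocalRing (Localization.AtPrime 𝔪) ∧ ringKrullDim (Localization.AtPrime 𝔪) = (d : WithBot ℕ∞)) →
    ∀ g₀ : K, (∀ c : K, c ^ p ≠ g₀) →
    ∃ T : Subalgebra k K, T.FG ∧ A ≤ T ∧ T.toSubring ≤ O.toSubring ∧
    ∀ O' : ValuationSubring K, T.toSubring ≤ O'.toSubring →
    CleanRegAt p (locAtCentre T.toSubring O').subtype g₀)
    (hZ : ∀ d : ℕ, 4 ≤ d → ∀ (p : ℕ), p.Prime → ∀ (k K : Type) [Field k] [CharP k p] [Field K] [Algebra k K]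
    [Algebra.EssFiniteType k K],
    Algebra.trdeg k K = d → ∀ (g₀ : K) (M₁ M₂ : ProjModel k K) (U₁ : M₁.X.Opens) (U₂ : M₂.X.Opens),
    (∀ x ∈ U₁, ModelCleanRegAt p g₀ M₁ x) → (∀ x ∈ U₂, ModelCleanRegAt p g₀ M₂ x) →
    ∃ (N : ProjModel k K) (φ₁ : N.Hom M₁) (φ₂ : N.Hom M₂),
    (∀ y : N.X, φ₁.f y ∈ U₁ → ModelCleanRegAt p g₀ N y) ∧ (∀ y : N.X, φ₂.f y ∈ U₂ → ModelCleanRegAt p g₀ N y)) :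
    ∀ p : ℕ, p.Prime → ∀ (k : Type) [Field k] [CharP k p] (W : AlgebraicGeometry.Scheme.{0}) [AlgebraicGeometry.IsIntegral W] (f : W ⟶ AlgebraicGeometry.Spec (.of k)) (L : Type) [Field L] [Algebra W.functionField L], AlgebraicGeometry.IsSeparated f → AlgebraicGeometry.LocallyOfFiniteType f → AlgebraicGeometry.QuasiCompact f → Literature.AlgebraicGeometry.Resolution.Scheme.IsRegular W → IsPurelyInseparable W.functionField L → Module.finrank W.functionField L = p → ¬ topologicalKrullDim W ≤ 3 → ∃ (V : AlgebraicGeometry.Scheme.{0}) (π : V ⟶ W) (_ : AlgebraicGeometry.IsIntegral V) (_ : AlgebraicGeometry.IsDominant π), AlgebraicGeometry.IsProper π ∧ Literature.AlgebraicGeometry.Resolution.IsBirational π ∧ Literature.AlgebraicGeometry.Resolution.Scheme.IsRegular V ∧ (∀ v : V, (∃ (y : L) (g : W.functionField), y ∉ Set.range (algebraMap W.functionField L) ∧ algebraMap W.functionField L g = y ^ p ∧ ((∃ (d m : ℕ) (hmd : m ≤ d) (t : Fin d → V.presheaf.stalk v) (a : Fin m → ℕ), Ideal.span (Set.range t) =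 IsLocalRing.maximalIdeal (V.presheaf.stalk v) ∧ ringKrullDim (V.presheaf.stalk v) = (d : WithBot ℕ∞) ∧ 0 < m ∧ (∀ i, ¬ p ∣ a i) ∧ Literature.AlgebraicGeometry.Motives.RatFn.functionFieldMap π g = ∏ i : Fin m, (algebraMap (V.presheaf.stalk v) V.functionField (t (Fin.castLE hmd i))) ^ (a i)) ∨ (∃ u₀ : V.presheaf.stalk v, IsUnit u₀ ∧ Literature.AlgebraicGeometry.Motives.RatFn.functionFieldMap π g = algebraMap (V.presheaf.stalk v) V.functionField u₀ ∧ ((∀ c : V.presheaf.stalk v, u₀ - c ^ p ∉ IsLocalRing.maximalIdeal (V.presheaf.stalk v)) ∨ (∃ c : V.presheaf.stalk v, u₀ - c ^ p ∈ IsLocalRing.maximalIdeal (V.presheaf.stalk v) ∧ u₀ - c ^ p ∉ IsLocalRing.maximalIdeal (V.presheaf.stalk v) ^ 2)))))) := by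
  intro p hp k _ _ W _ f L _ _ hsep hloc hqc hWreg hPI hdeg h3
  haveI := hsep; haveI := hloc; haveI := hqc
  obtain ⟨d, hd⟩ := exists_nat_topologicalKrullDim_eq f
  have h4 : 4 ≤ d := by
    by_contra hlt
    apply h3
    rw [hd]
    exact_mod_cast Nat.lt_succ_iff.mp (not_le.mp hlt)
  exact cleanModelsAt_of_logCleanPrincipalizationAt p hp k W f L hPI hdeg
    (fun g₀ hg₀ => cleanGlobalization_dim (hcharts d h4) (hZ d h4) p hp k W f hWreg hd g₀ hg₀)

/-- **The frontier stub `stub_cleanModelsDimGEFour` (statement VERBATIM) from CLEAN LOCAL UNIFORMIZATION AT ZERO-DIMENSIONAL VALUATIONS and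
TWO-MODEL PATCHING for `P_clean`, both in every dimension `d ≥ 4`** — the dim `≥ 4` twin of the skeleton's dim-3 chain
`cleanModelsDimThree_of_logCleanPrincipalizationDimThree ∘ stub_cleanGlobalization3 ∘ cleanCharts3_of_cleanLU3ZeroDim`: clean charts come from
clean LU by the dimension-free `cleanCharts_dim_of_cleanLUZeroDim_dim`, then `cleanModelsDimGEFour_of_cleanCharts_of_cleanTwoModelPatching`.
The two hypotheses are exactly the dim-`d` forms of the dim-3 node `cleanLU3_of_stubs` and of the landed stub 4b `stub_cleanTwoModelPatching3`;
both are OPEN for `d ≥ 4`.  Structural reduction only. [cite: Piltant2013, Cor. 5.7 and p. 2] -/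
theorem cleanModelsDimGEFour_of_cleanLUZeroDim_of_cleanTwoModelPatching
    (hLU : ∀ d : ℕ, 4 ≤ d → ∀ (p : ℕ), p.Prime →
    ∀ (k : Type) [Field k] [CharP k p] (K : Type) [Field K] [Algebra k K]
    (O : ValuationSubring K) (A : Subalgebra k K), A.toSubring ≤ O.toSubring → A.FG → IsFractionRing A K →
    ringKrullDim A ≤ (d : WithBot ℕ∞) → IsRegularLocalRing (locAtCentre A.toSubring O) →
    ringKrullDim (locAtCentre A.toSubring O) = (d : WithBot ℕ∞) →
    (∀ (T : Subring K) (hT : T ≤ O.toSubring), A.toSubring ≤ T → (subringCentre T O hT).IsMaximal) →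
    ∀ g₀ : K, (∀ c : K, c ^ p ≠ g₀) →
    ∃ (A' : Subalgebra k K), A'.toSubring ≤ O.toSubring ∧ A ≤ A' ∧ A'.FG ∧
    ∃ (_ : IsRegularLocalRing (locAtCentre A'.toSubring O)) (c : Fin p → K), (∃ j : Fin p, (j : ℕ) ≠ 0 ∧ c j ≠ 0) ∧
    ((∃ (d m : ℕ) (hmd : m ≤ d) (t : Fin d → ↥(locAtCentre A'.toSubring O)) (a : Fin m → ℕ) (u : ↥(locAtCentre A'.toSubring O)), IsUnit u ∧
    Ideal.span (Set.range t) = IsLocalRing.maximalIdeal ↥(locAtCentre A'.toSubring O) ∧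
    ringKrullDim ↥(locAtCentre A'.toSubring O) = (d : WithBot ℕ∞) ∧ 0 < m ∧ (∀ i, ¬ p ∣ a i) ∧
    (∑ j : Fin p, c j ^ p * g₀ ^ (j : ℕ)) = (u : K) * ∏ i : Fin m, ((t (Fin.castLE hmd i) : ↥(locAtCentre A'.toSubring O)) : K) ^ (a i)) ∨
    (∃ u : ↥(locAtCentre A'.toSubring O), IsUnit u ∧ (∑ j : Fin p, c j ^ p * g₀ ^ (j : ℕ)) = (u : K) ∧
    ∀ c' : ↥(locAtCentre A'.toSubring O), u - c' ^ p ∉ IsLocalRing.maximalIdeal ↥(locAtCentre A'.toSubring O)) ∨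
    (∃ s c' : ↥(locAtCentre A'.toSubring O), (∑ j : Fin p, c j ^ p * g₀ ^ (j : ℕ)) = (s : K) ∧
    s - c' ^ p ∈ IsLocalRing.maximalIdeal ↥(locAtCentre A'.toSubring O) ∧
    s - c' ^ p ∉ IsLocalRing.maximalIdeal ↥(locAtCentre A'.toSubring O) ^ 2)))
    (hZ : ∀ d : ℕ, 4 ≤ d → ∀ (p : ℕ), p.Prime → ∀ (k K : Type) [Field k] [CharP k p] [Field K] [Algebra k K]
    [Algebra.EssFiniteType k K],
    Algebra.trdeg k K = d → ∀ (g₀ : K) (M₁ M₂ : ProjModel k K) (U₁ : M₁.X.Opens) (U₂ : M₂.X.Opens),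
    (∀ x ∈ U₁, ModelCleanRegAt p g₀ M₁ x) → (∀ x ∈ U₂, ModelCleanRegAt p g₀ M₂ x) →
    ∃ (N : ProjModel k K) (φ₁ : N.Hom M₁) (φ₂ : N.Hom M₂),
    (∀ y : N.X, φ₁.f y ∈ U₁ → ModelCleanRegAt p g₀ N y) ∧ (∀ y : N.X, φ₂.f y ∈ U₂ → ModelCleanRegAt p g₀ N y)) :
    ∀ p : ℕ, p.Prime → ∀ (k : Type) [Field k] [CharP k p] (W : AlgebraicGeometry.Scheme.{0}) [AlgebraicGeometry.IsIntegral W] (f : W ⟶ AlgebraicGeometry.Spec (.of k)) (L : Type) [Field L] [Algebra W.functionField L], AlgebraicGeometry.IsSeparated f → AlgebraicGeometry.LocallyOfFiniteType f → AlgebraicGeometry.QuasiCompact f → Literature.AlgebraicGeometry.Resolution.Scheme.IsRegular W → IsPurelyInseparable W.functionField L → Module.finrank W.functionField L = p → ¬ topologicalKrullDim W ≤ 3 → ∃ (V : AlgebraicGeometry.Scheme.{0}) (π : V ⟶ W) (_ : AlgebraicGeometry.IsIntegral V) (_ : AlgebraicGeometry.IsDominant π), AlgebraicGeometry.IsProper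 π ∧ Literature.AlgebraicGeometry.Resolution.IsBirational π ∧ Literature.AlgebraicGeometry.Resolution.Scheme.IsRegular V ∧ (∀ v : V, (∃ (y : L) (g : W.functionField), y ∉ Set.range (algebraMap W.functionField L) ∧ algebraMap W.functionField L g = y ^ p ∧ ((∃ (d m : ℕ) (hmd : m ≤ d) (t : Fin d → V.presheaf.stalk v) (a : Fin m → ℕ), Ideal.span (Set.range t) = IsLocalRing.maximalIdeal (V.presheaf.stalk v) ∧ ringKrullDim (V.presheaf.stalk v) = (d : WithBot ℕ∞) ∧ 0 < m ∧ (∀ i, ¬ p ∣ a i) ∧ Literature.AlgebraicGeometry.Motives.RatFn.functionFieldMap π g = ∏ i : Fin m, (algebraMap (V.presheaf.stalk v) V.functionField (t (Fin.castLE hmd i))) ^ (a i)) ∨ (∃ u₀ : V.presheaf.stalk v, IsUnit u₀ ∧ Literature.AlgebraicGeometry.Motives.RatFn.functionFieldMap π g = algebraMap (V.presheaf.stalk v) V.functionField u₀ ∧ ((∀ c : V.presheaf.stalk v, u₀ - c ^ p ∉ IsLocalRing.maximalIdeal (V.presheaf.stalk v)) ∨ (∃ c : V.presheaf.stalk v,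 u₀ - c ^ p ∈ IsLocalRing.maximalIdeal (V.presheaf.stalk v) ∧ u₀ - c ^ p ∉ IsLocalRing.maximalIdeal (V.presheaf.stalk v) ^ 2)))))) :=
  cleanModelsDimGEFour_of_cleanCharts_of_cleanTwoModelPatching
    (fun d hd => cleanCharts_dim_of_cleanLUZeroDim_dim (hLU d hd)) hZ

end Summit.ResolutionOfSingularities.ResolutionOfSingularities.Theorems.RadicialJung.CleanModels

end
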